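import Literature.MathematicalPhysics.QuantumLattice.HubbardFermiGaussMap
import HarnessLib

/-!
# Rigidity of chord sums on the Hubbard Fermi curve: the quantitative core of the
parallelogram lemma (Benfatto–Giuliani–Mastropietro 2003, Lemma 7.5)

Topic `Literature/MathematicalPhysics/QuantumLattice`; continues `HubbardFermiSectorGeometry.lean`
(Cartesian parametrisation `p_F(θ) = (x, y)`, velocity `(x', y')`, acceleration bounds
`|x''|, |y''| ≤ A₂ = accelBound μ`, frame `τ = (x',y')/s'`, `n = (y',-x')/s'`, `s' = fermiSpeed`)
and `HubbardFermiGaussMap.lean` (normal angle `α = normalAngle`, `n = (cos α, sin α)`).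

BGM 2003, §7.3 (p. 27 of the arXiv text) consider the map `F(θ₁, θ₂) = p_F(θ₁) + p_F(θ₂)` ("the
parallelogram lemma"): "The differential `J(θ₁,θ₂)` of `F` is a matrix, whose columns coincide with
`s'(θ₁)τ(θ₁)` and `s'(θ₂)τ(θ₂)`. Then Lemma 7.1 implies that `det J ≠ 0`, hence `F` is invertible,
around any point `(θ₁,θ₂) ∈ 𝒯 = {sin(θ₁-θ₂) ≠ 0}`", and Lemma 7.5 makes this quantitative by Dini's
theorem: perturbing `F(θ̄₁,θ̄₂)` by `r` with `|r₁| ≤ c₁ηφ`, `|r₂| ≤ η ≤ c₂φ` (`φ` the angle between the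
two points) moves the solution by `|θᵢ - θ̄ᵢ| ≤ c₀η`. This file PROVES the analytic heart of that
statement — the UNIQUENESS/RIGIDITY half, which is what the sector counting consumes — with
explicit constants, directly from Taylor's formula (no implicit function theorem):

* `det` of the differential: `x'(θ₁)y'(θ₂) - y'(θ₁)x'(θ₂) = s'(θ₁)s'(θ₂) sin(α(θ₂) - α(θ₁))`
  (`fermiV_cross_eq`, from `x' = -s' sin α`, `y' = s' cos α`), i.e. `τ(θ₁)·n(θ₂) = sin(α₂ - α₁)`
  (BGM 2003 (A1.10));
* second-order Taylor bounds `|x(θ) - x(θ̄) - x'(θ̄)(θ - θ̄)| ≤ A₂ (θ - θ̄)²` (and for `y`);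
* **chord-sum rigidity** (`chordSum_rigidity_fst`, `_snd`): for all angles,
  `s'(θ̄₁)|sin(α(θ̄₂) - α(θ̄₁))|·|θ₁ - θ̄₁| ≤ |F(θ₁,θ₂) - F(θ̄₁,θ̄₂)| + 2A₂((θ₁-θ̄₁)² + (θ₂-θ̄₂)²)`
  and the same with the roles of the two points exchanged (`|F|` the Euclidean norm, written
  `√(ΔX² + ΔY²)`): so if two pairs of angles have chord sums within `r` of each other and lie within
  the rigidity radius `∼ |sin(α₂-α₁)|` of each other, they differ by `O(r/|sin(α₂-α₁)|)` — with
  `s' ≥ √(μ+4)` and the bi-Lipschitz Gauss map of Lemma 7.1 (`|sin(α₂-α₁)| ≍ φ`) this is the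
  `|θᵢ - θ̄ᵢ| ≤ c₀η` of Lemma 7.5.

Everything is PROVED; the only definitions are the chord-sum components `chordSumX`, `chordSumY`.

## Sources

* G. Benfatto, A. Giuliani, V. Mastropietro, Ann. Henri Poincaré 4 (2003) 137–193, §7.3
  (A1.19)–(A1.21), Lemma 7.5 (s1.16)–(s1.19a), and (A1.10) (arXiv:cond-mat/0207210 pp. 26–27).
  [BenfattoGiulianiMastropietro2003]
* G. Benfatto, A. Giuliani, V. Mastropietro, Ann. Henri Poincaré 7 (2006) 809–898, App. A2
  (A2.6)–(A2.11) (the same inversion in the proof of the sector counting lemma). [BenfattoGiulianiMastropietro2006]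
-/

noncomputable section

open Real Set Filter
open scoped Topology

namespace Literature.MathematicalPhysics.QuantumLattice

section Range

variable {μ : ℝ} (hμ₁ : -4 < μ) (hμ₂ : μ < -2 - Real.sqrt 2)
include hμ₁ hμ₂

/-! ### The determinant of the differential -/

/-- `y' = s' cos α`. [folklore] -/
theorem fermiVY_eq_speed_mul_cos (θ : ℝ) : fermiVY μ θ = fermiSpeed μ θ * Real.cos (normalAngle μ θ) := by
  have hs := fermiSpeed_pos hμ₁ hμ₂ θ
  rw [cos_normalAngle hμ₁ hμ₂]
  simp only [fermiNormal, Pi.smul_apply, smul_eq_mul, Matrix.cons_val_zero]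
  field_simp

/-- `x' = -s' sin α`. [folklore] -/
theorem fermiVX_eq_neg_speed_mul_sin (θ : ℝ) : fermiVX μ θ = -(fermiSpeed μ θ * Real.sin (normalAngle μ θ)) := by
  have hs := fermiSpeed_pos hμ₁ hμ₂ θ
  rw [sin_normalAngle hμ₁ hμ₂]
  simp only [fermiNormal, Pi.smul_apply, smul_eq_mul, Matrix.cons_val_one, Matrix.cons_val_zero]
  field_simp

/-- **The determinant of `DF`** (BGM 2003 (A1.10): `τ(θ₁)·n(θ₂) = sin(α₂ - α₁)`):
`x'(θ₁)y'(θ₂) - y'(θ₁)x'(θ₂) = s'(θ₁)s'(θ₂) sin(α(θ₂) - α(θ₁))`. [cite: BenfattoGiulianiMastropietro2003, §7.1 (A1.10)] -/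
theorem fermiV_cross_eq (θ₁ θ₂ : ℝ) :
    fermiVX μ θ₁ * fermiVY μ θ₂ - fermiVY μ θ₁ * fermiVX μ θ₂ =
      fermiSpeed μ θ₁ * fermiSpeed μ θ₂ * Real.sin (normalAngle μ θ₂ - normalAngle μ θ₁) := by
  rw [fermiVX_eq_neg_speed_mul_sin hμ₁ hμ₂, fermiVX_eq_neg_speed_mul_sin hμ₁ hμ₂,
    fermiVY_eq_speed_mul_cos hμ₁ hμ₂, fermiVY_eq_speed_mul_cos hμ₁ hμ₂, Real.sin_sub]
  ring

/-- Projection of a velocity onto the other point's unit normal: `p'(θ₁)·n(θ₂) = s'(θ₁) sin(α₂ - α₁)`. [cite: BenfattoGiulianiMastropietro2003, §7.1 (A1.10)] -/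
theorem fermiV_dot_fermiNormal (θ₁ θ₂ : ℝ) :
    fermiVX μ θ₁ * fermiNormal μ θ₂ 0 + fermiVY μ θ₁ * fermiNormal μ θ₂ 1 =
      fermiSpeed μ θ₁ * Real.sin (normalAngle μ θ₂ - normalAngle μ θ₁) := by
  have hs := fermiSpeed_pos hμ₁ hμ₂ θ₂
  have h := fermiV_cross_eq hμ₁ hμ₂ θ₁ θ₂
  simp only [fermiNormal, Pi.smul_apply, smul_eq_mul, Matrix.cons_val_zero, Matrix.cons_val_one]
  field_simp
  linear_combination h

/-! ### Second-order Taylor bounds along the curve -/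

/-- **Second-order Taylor bound for `x`**: `|x(θ) - x(θ̄) - x'(θ̄)(θ - θ̄)| ≤ A₂ (θ - θ̄)²`. [folklore] -/
theorem abs_fermiX_taylor_le (θ θ' : ℝ) :
    |fermiX μ θ - fermiX μ θ' - fermiVX μ θ' * (θ - θ')| ≤ accelBound μ * (θ - θ') ^ 2 := by
  set A := accelBound μ with hA
  have hA0 : 0 ≤ A := (abs_nonneg _).trans (abs_fermiAX_le hμ₁ hμ₂ 0)
  set g : ℝ → ℝ := fun t => fermiX μ t - fermiX μ θ' - fermiVX μ θ' * (t - θ') with hg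
  have hg' : ∀ t, HasDerivAt g (fermiVX μ t - fermiVX μ θ') t := by
    intro t
    have h := ((hasDerivAt_fermiX hμ₁ hμ₂ t).sub_const (fermiX μ θ')).sub
      (((hasDerivAt_id t).sub_const θ').const_mul (fermiVX μ θ'))
    refine h.congr_deriv ?_
    simp
  -- `|x'(t) - x'(θ')| ≤ A |t - θ'|`
  have hlip : ∀ t, |fermiVX μ t - fermiVX μ θ'| ≤ A * |t - θ'| := by
    intro t
    have h := (convex_univ (𝕜 := ℝ) (E := ℝ)).norm_image_sub_le_of_norm_hasDerivWithin_le
      (f := fermiVX μ) (f' := fermiAX μ) (fun u _ => (hasDerivAt_fermiVX hμ₁ hμ₂ u).hasDerivWithinAt)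
      (fun u _ => by rw [Real.norm_eq_abs]; exact abs_fermiAX_le hμ₁ hμ₂ u) (mem_univ θ') (mem_univ t)
    rwa [Real.norm_eq_abs, Real.norm_eq_abs] at h
  have hg0 : g θ' = 0 := by simp [hg]
  have h := (convex_uIcc θ' θ).norm_image_sub_le_of_norm_hasDerivWithin_le (f := g)
    (C := A * |θ - θ'|) (fun t _ => (hg' t).hasDerivWithinAt)
    (fun t ht => by
      rw [Real.norm_eq_abs]
      exact (hlip t).trans (mul_le_mul_of_nonneg_left (abs_sub_left_of_mem_uIcc ht) hA0))
    left_mem_uIcc right_mem_uIcc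
  rw [hg0, sub_zero, Real.norm_eq_abs, Real.norm_eq_abs] at h
  calc |fermiX μ θ - fermiX μ θ' - fermiVX μ θ' * (θ - θ')| = |g θ| := rfl
    _ ≤ A * |θ - θ'| * |θ - θ'| := h
    _ = A * (θ - θ') ^ 2 := by rw [mul_assoc, ← sq, sq_abs]

/-- **Second-order Taylor bound for `y`**. [folklore] -/
theorem abs_fermiY_taylor_le (θ θ' : ℝ) :
    |fermiY μ θ - fermiY μ θ' - fermiVY μ θ' * (θ - θ')| ≤ accelBound μ * (θ - θ') ^ 2 := by
  set A := accelBound μ with hA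
  have hA0 : 0 ≤ A := (abs_nonneg _).trans (abs_fermiAX_le hμ₁ hμ₂ 0)
  set g : ℝ → ℝ := fun t => fermiY μ t - fermiY μ θ' - fermiVY μ θ' * (t - θ') with hg
  have hg' : ∀ t, HasDerivAt g (fermiVY μ t - fermiVY μ θ') t := by
    intro t
    have h := ((hasDerivAt_fermiY hμ₁ hμ₂ t).sub_const (fermiY μ θ')).sub
      (((hasDerivAt_id t).sub_const θ').const_mul (fermiVY μ θ'))
    refine h.congr_deriv ?_
    simp
  have hlip : ∀ t, |fermiVY μ t - fermiVY μ θ'| ≤ A * |t - θ'| := by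
    intro t
    have h := (convex_univ (𝕜 := ℝ) (E := ℝ)).norm_image_sub_le_of_norm_hasDerivWithin_le
      (f := fermiVY μ) (f' := fermiAY μ) (fun u _ => (hasDerivAt_fermiVY hμ₁ hμ₂ u).hasDerivWithinAt)
      (fun u _ => by rw [Real.norm_eq_abs]; exact abs_fermiAY_le hμ₁ hμ₂ u) (mem_univ θ') (mem_univ t)
    rwa [Real.norm_eq_abs, Real.norm_eq_abs] at h
  have hg0 : g θ' = 0 := by simp [hg]
  have h := (convex_uIcc θ' θ).norm_image_sub_le_of_norm_hasDerivWithin_le (f := g)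
    (C := A * |θ - θ'|) (fun t _ => (hg' t).hasDerivWithinAt)
    (fun t ht => by
      rw [Real.norm_eq_abs]
      exact (hlip t).trans (mul_le_mul_of_nonneg_left (abs_sub_left_of_mem_uIcc ht) hA0))
    left_mem_uIcc right_mem_uIcc
  rw [hg0, sub_zero, Real.norm_eq_abs, Real.norm_eq_abs] at h
  calc |fermiY μ θ - fermiY μ θ' - fermiVY μ θ' * (θ - θ')| = |g θ| := rfl
    _ ≤ A * |θ - θ'| * |θ - θ'| := h
    _ = A * (θ - θ') ^ 2 := by rw [mul_assoc, ← sq, sq_abs]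

/-! ### Chord sums and their rigidity -/

omit hμ₁ hμ₂ in
/-- The `x`-component of the chord sum `F(θ₁, θ₂) = p_F(θ₁) + p_F(θ₂)` (BGM 2003 (A1.19)). [cite: BenfattoGiulianiMastropietro2003, §7.3 (A1.19)] -/
def chordSumX (μ θ₁ θ₂ : ℝ) : ℝ := fermiX μ θ₁ + fermiX μ θ₂

omit hμ₁ hμ₂ in
/-- The `y`-component of the chord sum. [cite: BenfattoGiulianiMastropietro2003, §7.3 (A1.19)] -/
def chordSumY (μ θ₁ θ₂ : ℝ) : ℝ := fermiY μ θ₁ + fermiY μ θ₂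

omit hμ₁ hμ₂ in
/-- Cauchy–Schwarz with a unit vector: `|aₓnₓ + a_yn_y| ≤ √(aₓ² + a_y²)` for `nₓ² + n_y² = 1`. [folklore] -/
theorem abs_dot_unit_le_sqrt {a b nx ny : ℝ} (hn : nx ^ 2 + ny ^ 2 = 1) :
    |a * nx + b * ny| ≤ Real.sqrt (a ^ 2 + b ^ 2) := by
  refine Real.abs_le_sqrt ?_
  nlinarith [sq_nonneg (a * ny - b * nx), sq_nonneg (a * nx + b * ny)]

omit hμ₁ hμ₂ in
/-- `p'(θ)·n(θ) = 0`. [folklore] -/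
theorem fermiV_dot_fermiNormal_self (μ θ : ℝ) :
    fermiVX μ θ * fermiNormal μ θ 0 + fermiVY μ θ * fermiNormal μ θ 1 = 0 := by
  simp only [fermiNormal, Pi.smul_apply, smul_eq_mul, Matrix.cons_val_zero, Matrix.cons_val_one]
  ring

omit hμ₁ hμ₂ in
/-- The elementary algebra behind the rigidity estimate: second-order expansions of the four
coordinates, a unit vector `(nₓ, n_y)` orthogonal to the second velocity and with projection `sσ`
of the first, give `s|σ||δ₁| ≤ |ΔF| + 2A(δ₁² + δ₂²)`. [folklore] -/
theorem rigidity_of_expansion {X₁ X₁' VX₁' X₂ X₂' VX₂' Y₁ Y₁' VY₁' Y₂ Y₂' VY₂' nx ny s σ A δ₁ δ₂ : ℝ}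
    (hx₁ : |X₁ - X₁' - VX₁' * δ₁| ≤ A * δ₁ ^ 2) (hx₂ : |X₂ - X₂' - VX₂' * δ₂| ≤ A * δ₂ ^ 2)
    (hy₁ : |Y₁ - Y₁' - VY₁' * δ₁| ≤ A * δ₁ ^ 2) (hy₂ : |Y₂ - Y₂' - VY₂' * δ₂| ≤ A * δ₂ ^ 2)
    (hunit : nx ^ 2 + ny ^ 2 = 1) (horth : VX₂' * nx + VY₂' * ny = 0) (hproj : VX₁' * nx + VY₁' * ny = s * σ)
    (hs : 0 < s) :
    s * |σ| * |δ₁| ≤ Real.sqrt (((X₁ + X₂) - (X₁' + X₂')) ^ 2 + ((Y₁ + Y₂) - (Y₁' + Y₂')) ^ 2) +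
      2 * A * (δ₁ ^ 2 + δ₂ ^ 2) := by
  set rx₁ := X₁ - X₁' - VX₁' * δ₁
  set rx₂ := X₂ - X₂' - VX₂' * δ₂
  set ry₁ := Y₁ - Y₁' - VY₁' * δ₁
  set ry₂ := Y₂ - Y₂' - VY₂' * δ₂
  have hΔX : (X₁ + X₂) - (X₁' + X₂') = VX₁' * δ₁ + VX₂' * δ₂ + (rx₁ + rx₂) := by simp only [rx₁, rx₂]; ring
  have hΔY : (Y₁ + Y₂) - (Y₁' + Y₂') = VY₁' * δ₁ + VY₂' * δ₂ + (ry₁ + ry₂) := by simp only [ry₁, ry₂]; ring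
  clear_value rx₁ rx₂ ry₁ ry₂
  set ΔX := (X₁ + X₂) - (X₁' + X₂')
  set ΔY := (Y₁ + Y₂) - (Y₁' + Y₂')
  clear_value ΔX ΔY
  -- project `ΔF` onto `n`
  have hdot : ΔX * nx + ΔY * ny = s * σ * δ₁ + ((rx₁ + rx₂) * nx + (ry₁ + ry₂) * ny) := by
    rw [hΔX, hΔY]
    linear_combination δ₁ * hproj + δ₂ * horth
  have hCS : |ΔX * nx + ΔY * ny| ≤ Real.sqrt (ΔX ^ 2 + ΔY ^ 2) := abs_dot_unit_le_sqrt hunit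
  have hnx1 : |nx| ≤ 1 := abs_le_one_iff_mul_self_le_one.2 (by nlinarith [sq_nonneg ny])
  have hny1 : |ny| ≤ 1 := abs_le_one_iff_mul_self_le_one.2 (by nlinarith [sq_nonneg nx])
  have hrem : |(rx₁ + rx₂) * nx + (ry₁ + ry₂) * ny| ≤ 2 * A * (δ₁ ^ 2 + δ₂ ^ 2) := by
    have h1 : |(rx₁ + rx₂) * nx| ≤ |rx₁| + |rx₂| := by
      rw [abs_mul]
      exact (mul_le_of_le_one_right (abs_nonneg _) hnx1).trans (abs_add_le _ _)
    have h2 : |(ry₁ + ry₂) * ny| ≤ |ry₁| + |ry₂| := by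
      rw [abs_mul]
      exact (mul_le_of_le_one_right (abs_nonneg _) hny1).trans (abs_add_le _ _)
    calc _ ≤ |(rx₁ + rx₂) * nx| + |(ry₁ + ry₂) * ny| := abs_add_le _ _
      _ ≤ (|rx₁| + |rx₂|) + (|ry₁| + |ry₂|) := add_le_add h1 h2
      _ ≤ _ := by linarith
  have hkey : s * σ * δ₁ = (ΔX * nx + ΔY * ny) - ((rx₁ + rx₂) * nx + (ry₁ + ry₂) * ny) := by
    rw [hdot]; ring
  calc s * |σ| * |δ₁| = |s * σ * δ₁| := by rw [abs_mul, abs_mul, abs_of_pos hs]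
    _ = |(ΔX * nx + ΔY * ny) - ((rx₁ + rx₂) * nx + (ry₁ + ry₂) * ny)| := by rw [hkey]
    _ ≤ |ΔX * nx + ΔY * ny| + |(rx₁ + rx₂) * nx + (ry₁ + ry₂) * ny| := abs_sub _ _
    _ ≤ _ := add_le_add hCS hrem

/-- **Chord-sum rigidity, first point** (quantitative core of BGM 2003 Lemma 7.5): for all angles,
`s'(θ̄₁)·|sin(α(θ̄₂) - α(θ̄₁))|·|θ₁ - θ̄₁| ≤ |F(θ₁,θ₂) - F(θ̄₁,θ̄₂)| + 2A₂((θ₁-θ̄₁)² + (θ₂-θ̄₂)²)`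
(project `F(θ) - F(θ̄) = DF(θ̄)(θ - θ̄) + O(|θ-θ̄|²)` onto the normal `n(θ̄₂)`, which kills the second
column of `DF`). [cite: BenfattoGiulianiMastropietro2003, §7.3 Lemma 7.5] -/
theorem chordSum_rigidity_fst (θ₁ θ₂ θ₁' θ₂' : ℝ) :
    fermiSpeed μ θ₁' * |Real.sin (normalAngle μ θ₂' - normalAngle μ θ₁')| * |θ₁ - θ₁'| ≤
      Real.sqrt ((chordSumX μ θ₁ θ₂ - chordSumX μ θ₁' θ₂') ^ 2 + (chordSumY μ θ₁ θ₂ - chordSumY μ θ₁' θ₂') ^ 2) +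
        2 * accelBound μ * ((θ₁ - θ₁') ^ 2 + (θ₂ - θ₂') ^ 2) :=
  rigidity_of_expansion (abs_fermiX_taylor_le hμ₁ hμ₂ θ₁ θ₁') (abs_fermiX_taylor_le hμ₁ hμ₂ θ₂ θ₂')
    (abs_fermiY_taylor_le hμ₁ hμ₂ θ₁ θ₁') (abs_fermiY_taylor_le hμ₁ hμ₂ θ₂ θ₂')
    (fermiNormal_normSq hμ₁ hμ₂ θ₂') (fermiV_dot_fermiNormal_self μ θ₂')
    (fermiV_dot_fermiNormal hμ₁ hμ₂ θ₁' θ₂') (fermiSpeed_pos hμ₁ hμ₂ θ₁')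

/-- **Chord-sum rigidity, second point**: the same with the two points exchanged,
`s'(θ̄₂)·|sin(α(θ̄₁) - α(θ̄₂))|·|θ₂ - θ̄₂| ≤ |F(θ₁,θ₂) - F(θ̄₁,θ̄₂)| + 2A₂((θ₁-θ̄₁)² + (θ₂-θ̄₂)²)`. [cite: BenfattoGiulianiMastropietro2003, §7.3 Lemma 7.5] -/
theorem chordSum_rigidity_snd (θ₁ θ₂ θ₁' θ₂' : ℝ) :
    fermiSpeed μ θ₂' * |Real.sin (normalAngle μ θ₁' - normalAngle μ θ₂')| * |θ₂ - θ₂'| ≤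
      Real.sqrt ((chordSumX μ θ₁ θ₂ - chordSumX μ θ₁' θ₂') ^ 2 + (chordSumY μ θ₁ θ₂ - chordSumY μ θ₁' θ₂') ^ 2) +
        2 * accelBound μ * ((θ₁ - θ₁') ^ 2 + (θ₂ - θ₂') ^ 2) := by
  have h := chordSum_rigidity_fst hμ₁ hμ₂ θ₂ θ₁ θ₂' θ₁'
  have hX : chordSumX μ θ₂ θ₁ - chordSumX μ θ₂' θ₁' = chordSumX μ θ₁ θ₂ - chordSumX μ θ₁' θ₂' := by
    simp only [chordSumX]; ring
  have hY : chordSumY μ θ₂ θ₁ - chordSumY μ θ₂' θ₁' = chordSumY μ θ₁ θ₂ - chordSumY μ θ₁' θ₂' := by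
    simp only [chordSumY]; ring
  rw [hX, hY] at h
  linarith

end Range

end Literature.MathematicalPhysics.QuantumLattice

end
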